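import Summits.HodgeConjecture.HodgeConjecture.Theorems.F0P3cStCharTSVanDijkHC         -- (F0P3a-p07 (g17)) «VDW-CORE» file 2: (A6) `norm_ofReal_vanDijkWeight_re_mul_le_of_hcBound` (over (A4) the junction `√√‖u‖ = Re Δ`, (A5), and `Δ = 0` off the regular set); brings file 1 `…VanDijkCore`
import Summits.HodgeConjecture.HodgeConjecture.Theorems.F0P3cStCharTSTorusChartIso     -- ★ p849607 `continuous_torusChart`
import Summits.HodgeConjecture.HodgeConjecture.Theorems.F0P3cStCharTSTorusCompactPart  -- ★ p849333 `isCompact_torusCompactPart` (`M_c = 𝒪_vˣ × E¹_v` compact at a non-split `v`)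
import Literature.NumberTheory.Rogawski1990.Ch12Sec7CharacterInputs                    -- ★ p850727 (F-b) the NAMED FACT `normalizedCharacter_locallyBounded` [HarishChandra1999 Thm. 16.3] (UNPROVED ⇒ a hypothesis here)
import Literature.NumberTheory.Rogawski1990.Ch12Sec5Inputs                             -- ★ (M1) `EllipticData.CharRegularity`
import Literature.NumberTheory.Automorphic.LocalUnitaryGroupCongr                      -- ★ `antidiagOne_isHermitian`, `isUnit_antidiagOne_det` (the antecedents of (F-b) at `Φ₃`)
import HarnessLib

/-!
# F0 · P3c · line LH6 «StCharTS» — brick «HB-ON-MC★»: `|D_G|^{1/2}·χ_σ` IS BOUNDED ON THE COMPACT PART `M_c` OF THE SPLIT TORUS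
# (the (HCB σ) clause of the (TOR⁵) socket of the (S-𝔇) package, from Harish-Chandra's local boundedness (F-b) + (M1) + the van Dijk weight junction)

Cell `hodgecm-mathlib`, crux `H413` (`stmt-HodgeConjecture-24833`), line LH6 `Cruxes/H413/Lines/F0_P3c_StCharTSPaydown.lean`, organ (S-𝔇) `stub_EllipticPackage`; road (L1M)
piece ③ (desk F0P3-plan (g15) re-deal 2026-09-02T09:18:17Z (1) to LH6-p04 (g4)).  THEOREMS ONLY (no `def`, no named fact, no `instance`, no notation, no `sorry`; axioms
⊆ {propext, Classical.choice, Quot.sound}); `--supports stmt-HodgeConjecture-24833 --as helper`.  HONEST LABEL: HC_CM is proved only modulo the 7 printed citations (2 remaining: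
hLiu418 = stmt-HodgeConjecture-24832, h413 = stmt-HodgeConjecture-24833) until rung 0 closes; this file is count-neutral and CONDITIONAL BY CONSTRUCTION: its theorems take the
PRINTED named fact (F-b) ★ `Rogawski1990.normalizedCharacter_locallyBounded` ([HarishChandra1999AdmissibleDistributions, Thm. 16.3]; an UNPROVED `def … : Prop` of the tree) as the
hypothesis `hHC` — they DERIVE the (HCB σ) sentence of head ₈'s socket (TOR⁵) from it, they do not discharge it.

THE MATHEMATICS ([Rogawski1990, L. 12.7.2 (proof) p. 193]: «for all square-integrable `π`, the restriction of `D_G(γ)χ_π(γ)` to `M` is an integrable function» — the part of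
that sentence on the compact `M_c = 𝒪_vˣ × E¹_v`, where `D_G = |D|^{1/2}` vanishes at the singular points and `χ_π` alone is unbounded).  Harish-Chandra (F-b): for every compact
`C ⊆ G = U(Φ₃)(L⁺_v)` there is `B` with `|D_G(g)|^{1/2}·|Θ(g)| ≤ B` for the regular `g ∈ C`, `Θ` the character of an irreducible class as a function ((M1): locally integrable,
locally constant on `G^r`, representing the trace) — TYPED with the weight `√√‖u‖` for the units `u` with `u·det(g)² = disc(charpoly g)`.  On the diagonal torus the «VDW-CORE»
junction of F0P3a-p07 identifies this weight with van Dijk's: `√√‖u‖ = Re Δ(t)` ((A4) `coe_sqrt_sqrt_unitModulusChar_eq_vanDijkWeight_re`), such a `u` existing iff `t` is regular in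
`Δ`'s sense ((A5) `exists_unit_mul_det_sq_eq_discr_iff`), while `Δ(t) = 0` at the non-regular `t` (★ `vanDijkWeight_eq_zero_of_not`).  Hence `‖Re Δ(t)·Θ(t)‖ ≤ max B 0` on
every compact `C` (§1), and `C := ι(M_c)` is compact (★ `isCompact_torusCompactPart`, ★ `continuous_torusChart`) — (HCB σ) for `Θ := 𝔇.char σ` of any §12.5 datum carrying (M1)
and the organ's COMPAT clauses `𝔇.μG = νQv`, `regG ↔ IsRegularElt` (§2).

* §1 `exists_bound_vanDijkWeight_re_mul_of_hcBounded` — any `Θ` with the three (M1)-clauses, any compact `C ⊆ U(Φ₃)(L⁺_v)`.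
* §2 `exists_bound_char_on_torusCompactPart` — (HCB σ) of (TOR⁵) VERBATIM: `∃ B, ∀ m ∈ M_c, ‖Re Δ(ι m) · 𝔇.char σ (ι m)‖ ≤ B` for every `𝔇.IsL2 σ`.
NOT HERE: the `χ_ρ^G` twin (HCB-up) — (F-b) is a statement about characters of irreducible classes of `G`; `𝔇.up (packetCharH {πSt})` needs Lemma 12.5.1 and Harish-Chandra on
`H = U(2) × U(1)` (F0P2-p06 (g16)'s H-side census).

## References
* [Rogawski1990] J. D. Rogawski, *Automorphic Representations of Unitary Groups in Three Variables*, Ann. of Math. Stud. 123 (1990): §1.6 p. 5; §4.9 p. 54; §12.7 Lemma 12.7.2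
  (proof) p. 193.
* [HarishChandra1999AdmissibleDistributions] Harish-Chandra (notes by S. DeBacker, P. J. Sally, Jr.), *Admissible Invariant Distributions on Reductive p-adic Groups*, AMS ULS 16
  (1999): Part III §16, Thm. 16.3.
-/

set_option autoImplicit false
-- the mandated namespace has the single-problem summit's repeated segment (`HodgeConjecture.HodgeConjecture`)
set_option linter.dupNamespace false

noncomputable section

open MeasureTheory Filter Topology
open NumberField IsDedekindDomain
open scoped NNReal
open Literature.NumberTheory.Automorphic Literature.NumberTheory.Automorphic.UnitaryGroup Literature.NumberTheory.Rogawski1990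

namespace Summit.HodgeConjecture.HodgeConjecture.Cruxes.H413.F0P3cStCharTSHbOnMc

open F0P3cStCharTSTorusDefs

variable (L : Type) [Field L] [NumberField L] [IsCMField L] (v : HeightOneSpectrum (𝓞 ↥(maximalRealSubfield L)))

/-! ## §1 Harish-Chandra's bound read through van Dijk's weight on the diagonal torus -/

/-- **`‖Re Δ(t) · Θ(t)‖` is bounded on every compact set**, for `Θ` a Harish-Chandra character function of an irreducible class of `U(Φ₃)(L⁺_v)` ((M1)-clauses: locally
integrable, locally constant at the regular points, representing the trace), GIVEN the named fact (F-b) ★ `normalizedCharacter_locallyBounded` (hypothesis `hHC`).  Regular `t`: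
(F-b)'s weight `√√‖u‖`, `u·det² = disc`, IS `Re Δ(t)`, and `Δ(t) = 0` at non-regular `t` — both packaged in «VDW-CORE» (A6) ★ `F0P3cStCharTSVanDijkHC.norm_ofReal_vanDijkWeight_re_mul_le_of_hcBound`.
[cite: HarishChandra1999AdmissibleDistributions, Part III §16 Thm. 16.3] [cite: Rogawski1990, §12.7 Lemma 12.7.2 (proof) p. 193; §4.9 p. 54] -/
theorem exists_bound_vanDijkWeight_re_mul_of_hcBounded (hHC : normalizedCharacter_locallyBounded)
    (hns : ∀ w : PlacesOver L v, IsCMField.complexConj L • w.1 = w.1)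
    [MeasurableSpace (Gqs L v)] [BorelSpace (Gqs L v)] (νQv : Measure (Gqs L v)) [νQv.IsHaarMeasure]
    (σ : IrrClass (Gqs L v)) (Θ : Gqs L v → ℂ) (hΘli : LocallyIntegrable Θ νQv)
    (hΘlc : ∀ x : Gqs L v, IsRegularElt (x.val : GL (Fin 3) (UnitaryGroup.LocalRing L v)) → ∀ᶠ y in 𝓝 x, Θ y = Θ x)
    (hΘtr : ∀ φ : Gqs L v → ℂ, IsLocSmooth φ → σ.smoothTrace νQv φ = ∫ x, φ x * Θ x ∂νQv)
    {C : Set (Gqs L v)} (hC : IsCompact C) :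
    ∃ B : ℝ, ∀ t : ↥(cmBorelTriple L 3 v).M,
      ((t : ↥(unitaryGroupOfForm (conjLocal L (IsCMField.complexConj L) v) (cmLocalForm L 3 v))) : Gqs L v) ∈ C →
        ‖(((vanDijkWeight L v t).re : ℝ) : ℂ) * Θ ((t : ↥(unitaryGroupOfForm (conjLocal L (IsCMField.complexConj L) v) (cmLocalForm L 3 v))) : Gqs L v)‖ ≤ B := by
  obtain ⟨B, hB⟩ := hHC L 3 (qsForm L) (antidiagOne_isHermitian L 3) (isUnit_antidiagOne_det L 3).ne_zero v νQv σ Θ hΘli hΘlc hΘtr C hC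
  exact ⟨max B 0, fun t ht => F0P3cStCharTSVanDijkHC.norm_ofReal_vanDijkWeight_re_mul_le_of_hcBound L v hns hB t ht⟩

/-! ## §2 (HCB σ): the bound on `M_c` for the datum's character `𝔇.char σ` -/

/-- **(HCB σ) of (TOR⁵) — `Re Δ(ι m) · χ_σ(ι m)` IS BOUNDED ON `M_c = 𝒪_vˣ × E¹_v`** (`v` NON-SPLIT), for every §12.5 datum `𝔇` on `U(Φ₃)(L⁺_v)` carrying (M1) ★ `CharRegularity` with
`𝔇.μG = νQv` and `𝔇.regG ↔ IsRegularElt` (the organ's COMPAT clauses) and every square-integrable class `σ` (`𝔇.IsL2 σ`), GIVEN (F-b) `hHC`: §1 on the compact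
`C := ι(M_c)` (★ `isCompact_torusCompactPart`, ★ `continuous_torusChart`).  The conclusion is the (HCB σ) clause of ★ ₈'s socket (TOR⁵) token for token.
[cite: Rogawski1990, §12.7 Lemma 12.7.2 (proof) p. 193] [cite: HarishChandra1999AdmissibleDistributions, Part III §16 Thm. 16.3] -/
theorem exists_bound_char_on_torusCompactPart (hHC : normalizedCharacter_locallyBounded)
    (hns : ∀ w : PlacesOver L v, IsCMField.complexConj L • w.1 = w.1)
    [MeasurableSpace (Gqs L v)] [BorelSpace (Gqs L v)]
    [∀ γ : Gqs L v, MeasurableSpace (Gqs L v ⧸ Subgroup.centralizer ({γ} : Set (Gqs L v)))] [MeasurableSpace (Gqs L v ⧸ Subgroup.center (Gqs L v))]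
    {H : Type} [Group H] [TopologicalSpace H] [IsTopologicalGroup H] [MeasurableSpace H]
    (νQv : Measure (Gqs L v)) [νQv.IsHaarMeasure]
    (𝔇 : Ch12Sec5.EllipticData (Gqs L v) H) (hM1 : 𝔇.CharRegularity) (hμG : 𝔇.μG = νQv)
    (hreg : ∀ γ : Gqs L v, γ ∈ 𝔇.regG ↔ IsRegularElt (γ.val : GL (Fin 3) (UnitaryGroup.LocalRing L v)))
    (σ : IrrClass (Gqs L v)) (hσ : 𝔇.IsL2 σ) :
    ∃ B : ℝ, ∀ m : ((UnitaryGroup.LocalRing L v)ˣ × ↥(normOneUnits (conjLocal L (IsCMField.complexConj L) v))),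
      m ∈ (((Submonoid.pi Set.univ (fun w : PlacesOver L v => (w.1.adicCompletionIntegers L).toSubring.toSubmonoid)).units.prod (⊤ : Subgroup ↥(normOneUnits (conjLocal L (IsCMField.complexConj L) v)))) : Subgroup ((UnitaryGroup.LocalRing L v)ˣ × ↥(normOneUnits (conjLocal L (IsCMField.complexConj L) v)))) →
        ‖(((vanDijkWeight L v (torusChart L v m)).re : ℝ) : ℂ) * 𝔇.char σ (((torusChart L v m : ↥(cmBorelTriple L 3 v).M) : ↥(unitaryGroupOfForm (conjLocal L (IsCMField.complexConj L) v) (cmLocalForm L 3 v))) : Gqs L v)‖ ≤ B := by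
  obtain ⟨-, hli, hlc, htr⟩ := hM1 σ hσ
  rw [hμG] at hli htr
  have hlc' : ∀ x : Gqs L v, IsRegularElt (x.val : GL (Fin 3) (UnitaryGroup.LocalRing L v)) → ∀ᶠ y in 𝓝 x, 𝔇.char σ y = 𝔇.char σ x :=
    fun x hx => hlc x ((hreg x).2 hx)
  -- the compact `ι(M_c)`
  have hι : Continuous fun m : ((UnitaryGroup.LocalRing L v)ˣ × ↥(normOneUnits (conjLocal L (IsCMField.complexConj L) v))) =>
      (((torusChart L v m : ↥(cmBorelTriple L 3 v).M) : ↥(unitaryGroupOfForm (conjLocal L (IsCMField.complexConj L) v) (cmLocalForm L 3 v))) : Gqs L v) :=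
    continuous_subtype_val.comp (F0P3cStCharTSTorusChartIso.continuous_torusChart L v)
  have hC := (F0P3cStCharTSTorusCompactPart.isCompact_torusCompactPart L v hns).image hι
  obtain ⟨B, hB⟩ := exists_bound_vanDijkWeight_re_mul_of_hcBounded L v hHC hns νQv σ (𝔇.char σ) hli hlc' htr hC
  exact ⟨B, fun m hm => hB (torusChart L v m) (Set.mem_image_of_mem _ hm)⟩

end Summit.HodgeConjecture.HodgeConjecture.Cruxes.H413.F0P3cStCharTSHbOnMc

end
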